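import Literature.ComputerArithmetic.LangloisLouvet2006.CompHorner

/-!
# Interval enclosures from classic and compensated algorithms run under a directed rounding
(Graillat–Jézéquel 2020)

HONEST FRAMING (ENGINES group, unit `eng-quad-4`, kernels lane of the `certquad` engine — shared
numerical engines serving client cells; rigour lives in the verifiers; every published number
belongs to a client cell's ledger, not to the engines group): the kernels publish TWO-SIDED
enclosures obtained by running a summation / dot product / polynomial evaluation once with every
operation rounded toward `-∞` and once toward `+∞`. This file types and proves, in MODEL form
exactly as `Higham2002/Horner.lean` (`hornerRd_enclosure`), the published justification of that
device for the classic AND the compensated algorithms: a directed rounding is a map `rd : K → K`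
with `t ≤ rd t` for every `t` (rounding toward `+∞`) or `rd t ≤ t` for every `t` (toward `-∞`), and
NOTHING ELSE about `rd` is used by the enclosure theorems. No hardware, vendor, timing or format
claims; the format-level provisos of the paper (no underflow for products, the exactness analyses
of `FastTwoSum` / `TwoSum` under a directed rounding) are HYPOTHESES here (trace forms) or built
into the model (literal forms), to be discharged per format elsewhere.

Source read at the page: [GraillatJezequel2020] (IEEE Trans. Comput. 69 (2020) 1774–1783),
Sections 3–6; the numbering below is the journal's.

Typed and PROVED (ordered field `K`; data `p, x, y, a : ℕ → K`; `n + 1` summands / degree `n`):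

* SECTION 3 (error-free transformations under a directed rounding, MODEL form).
  `fastTwoSum_err_le_corr` / `fastTwoSum_corr_le_err` — PROPOSITION 3.3: with `x = rd (a + b)`,
  `e = a + b - x` and the computed correction `y = rd e` (PROPOSITION 3.1, the paper's ref. [24]:
  `z = x - a` is computed exactly, whence `y = fl(b - z) = fl(e)` — taken here as the DEFINITION of
  the model correction), `e ≤ y` under rounding toward `+∞` and `y ≤ e` toward `-∞`;
  `abs_fastTwoSum_err_sub_corr_le` (and `…'`) — PROPOSITION 3.2 in the model `|rd t - t| ≤ v |t|`
  (`v = 2u` for a directed rounding, [GraillatJezequel2020, §2 eq. (1)]): `|e - y| ≤ v² |a + b|`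
  (printed `4u² |a + b|`) and, with also `|rd t - t| ≤ v |rd t|`, `|e - y| ≤ v² |x|`.
* SECTION 4 (summation). `sumRd` = Algorithm 4 with every addition rounded by `rd`;
  `sumRd_le_sum`, `sum_le_sumRd`, `sumRd_enclosure` — PROPOSITION 4.3 (Algorithm 5:
  `Sinf ≤ Σ pᵢ ≤ Ssup`). `fcsErr`, `fcsCorr`, `fcsSigma`, `fastCompSum` = Algorithm 6
  (`FastCompSum`; its high part `πᵢ` IS the classic running sum `sumRd`) with every operation
  rounded by `rd`; `sum_eq_acc_add_sum_err` / `sum_eq_sumRd_add_sum_fcsErr` — the identity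
  `s = πₙ + Σ eᵢ` opening the proof of Proposition 4.6; `add_sum_le_of_acc_le` /
  `le_add_sum_of_le_acc` — its step "as we use rounding toward `+∞`, `Σ qᵢ ≤ σₙ`";
  `sum_le_of_compSum_trace` / `compSum_trace_le_sum` — the proof of PROPOSITION 4.6 for ANY trace
  `π, q, σ, res` with `eᵢ ≤ qᵢ` (resp. `qᵢ ≤ eᵢ`) and monotone accumulation, hence also for the
  `TwoSum`-compensated variant (closing remark of §4.2; PROPOSITION 3.6 supplies `eᵢ ≤ qᵢ`);
  `sum_le_fastCompSum`, `fastCompSum_le_sum`, `fastCompSum_enclosure` — PROPOSITION 4.6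
  (Algorithm 7: `Sinf ≤ Σ pᵢ ≤ Ssup`).
* SECTION 5 (dot product). `dotRd` = Algorithm 8 with every operation rounded by `rd`;
  `dotRd_le_dot`, `dot_le_dotRd`, `dotRd_enclosure` — PROPOSITION 5.3 (Algorithm 9:
  `Dinf ≤ xᵀy ≤ Dsup`). `dot_eq_compDot_trace` — the identity `xᵀy = pₙ + s₁ + Σ (eᵢ + rᵢ)`
  opening the proof of Proposition 5.6 (the paper's ref. [14, Prop. 4.5]);
  `dot_le_of_compDot_trace` / `compDot_trace_le_dot` — the proof of PROPOSITION 5.6 for any trace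
  of Algorithm 10 (`CompDot`: `TwoProdFMA` exact, `hᵢ + rᵢ = xᵢ yᵢ`; `TwoSum` correction with
  `eᵢ ≤ qᵢ` resp. `qᵢ ≤ eᵢ` — PROPOSITION 3.6, a HYPOTHESIS; monotone accumulation); `cdS`,
  `compDotRd` = Algorithm 10 rounded by `rd`, its `TwoSum` correction an ORACLE `cr : K → K → K`
  assumed to satisfy Proposition 3.6's conclusion; `dot_le_compDotRd`, `compDotRd_le_dot`,
  `compDotRd_enclosure` — PROPOSITION 5.6 (Algorithm 11: `Dinf ≤ xᵀy ≤ Dsup`).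
* SECTION 6 (Horner scheme, `x ≥ 0`). PROPOSITION 6.1 (Algorithm 13) is ALREADY in tree as
  `Higham2002.hornerRd_enclosure` (with `hornerRd` = Algorithm 12 rounded by `rd`) and is not
  restated. `sum_mul_pow_le_of_horner_acc` / `le_sum_mul_pow_of_horner_acc` — the step "as we use
  rounding toward `+∞`, `p(x) ≤ s₀ + r₀`"; `sum_le_of_compHorner_trace` / `compHorner_trace_le_sum`
  — the proof of PROPOSITION 6.3 for any trace of Algorithm 14 (`CompHorner`: `sᵢ₊₁ x = pᵢ + πᵢ`
  exact by `TwoProdFMA`; `pᵢ + aᵢ = sᵢ + τᵢ` with the computed `σᵢ ≥ τᵢ` resp. `≤ τᵢ` by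
  PROPOSITION 3.3; `rᵢ ≥ rᵢ₊₁ x + (πᵢ + σᵢ)` resp. `≤`), through the exact identity
  `p(x) = s₀ + p_π(x) + p_τ(x)` (`LangloisLouvet2006.eftHorner_add_sum_eq`); `compHornerRdCorr`,
  `compHornerRd` = Algorithm 14 rounded by `rd` (its `s₀` is `Higham2002.hornerRd`);
  `sum_le_hornerRd_add_compHornerRdCorr`, `hornerRd_add_compHornerRdCorr_le_sum`,
  `sum_le_compHornerRd`, `compHornerRd_le_sum`, `compHornerRd_enclosure` — PROPOSITION 6.3
  (Algorithm 15: `Einf ≤ p(x) ≤ Esup`).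

PARAMETERS / ENCODING. Indices start at `0`: `n + 1` summands `p₀ … pₙ` (the paper's
`p₁ … pₙ`); step `i < n` combines the running value with `pᵢ₊₁` and produces the correction of
index `i`; polynomials have degree `n`, coefficients `a₀ … aₙ`. A directed rounding enters ONLY
through `∀ t, t ≤ rd t` / `∀ t, rd t ≤ t`; the enclosure theorems therefore need no unit roundoff,
no `n u < 1/2`, and hold in any linearly ordered field (`ℚ` for the exact replay of a logged run,
`ℝ` for the textbook). In the model `rd` acts on the exact real result, so the operand order of a
rounded addition is immaterial (Algorithm 8 writes `xᵢ yᵢ + sᵢ₋₁`, Algorithm 10 `pᵢ₋₁ + hᵢ`; one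
definition `dotRd` serves both). `TwoProdFMA` is EXACT under any rounding mode barring underflow
([GraillatJezequel2020, §3.2]): modelled by `h = rd (x y)`, `r = x y - h` (literal forms) or by the
hypothesis `h + r = x y` (trace forms). Lower-bound theorems mirror the upper-bound ones.
As in `Horner.lean`, Horner-type inductions peel off the last step `i = 0` and recurse on the
shifted sequences `a ∘ succ, …` (`Higham2002.sum_mul_pow_succ_eq`).

NOT HERE: the accuracy bounds PROPOSITIONS 4.1, 4.4, 5.1, 5.4, 6.2 and COROLLARIES 4.2, 4.5, 5.2,
5.5 (the classic ones are `Higham2002/Summation.lean`, `Horner.lean` read with `u ↦ 2u`; the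
compensated ones — `2u|s| + 2(1+2u)γₙ²(2u)S` etc. — are proved in the paper's refs. [13], [14]);
the FORMAT-level statements PROPOSITION 3.1, LEMMA 3.5 (Sterbenz), THEOREM 3.4 and the case
analysis proving PROPOSITION 3.6 (`TwoSum` under a directed rounding) — the conclusion of 3.6
appears here only as a hypothesis / oracle property; the reflection `p̄(-x)` for `x ≤ 0`;
Sections 7–8 (implementations, timings, interval libraries).
-/

namespace Literature.ComputerArithmetic.GraillatJezequel2020

open Finset Literature.ComputerArithmetic.Higham2002
open Literature.ComputerArithmetic.LangloisLouvet2006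

variable {K : Type*} [Field K] [LinearOrder K] [IsStrictOrderedRing K]

/-! ## Section 3: `FastTwoSum` under a directed rounding (model form) -/

omit [IsStrictOrderedRing K] in
/-- PROPOSITION 3.3, rounding toward `+∞` (model form). With `x = rd (a + b)`, `e = a + b - x` and
the computed correction `y = rd e` (by PROPOSITION 3.1, `z = x - a` is exact, so
`y = fl(b - z) = fl(e)`): if `t ≤ rd t` for every `t` then `e ≤ y`. In the model this is that
hypothesis at `t = e`; the content of the printed proof is Proposition 3.1 (format level).
[cite: GraillatJezequel2020, §3.1.1 Propositions 3.1 and 3.3] -/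
theorem fastTwoSum_err_le_corr {rd : K → K} (hup : ∀ t, t ≤ rd t) (a b : K) :
    a + b - rd (a + b) ≤ rd (a + b - rd (a + b)) :=
  hup _

omit [IsStrictOrderedRing K] in
/-- PROPOSITION 3.3, rounding toward `-∞` (model form): if `rd t ≤ t` for every `t` then the
computed correction `y = rd e` satisfies `y ≤ e`, `e = a + b - rd (a + b)`.
[cite: GraillatJezequel2020, §3.1.1 Propositions 3.1 and 3.3] -/
theorem fastTwoSum_corr_le_err {rd : K → K} (hdn : ∀ t, rd t ≤ t) (a b : K) :
    rd (a + b - rd (a + b)) ≤ a + b - rd (a + b) :=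
  hdn _

/-- PROPOSITION 3.2 (model form, first display). If `|rd t - t| ≤ v |t|` for every `t` (`v = 2u`
for a directed rounding) then, with `e = a + b - rd (a + b)` and `y = rd e`,
`|e - y| ≤ v² |a + b|` (printed: `|e - y| ≤ 4u² |a + b|`): `|e - y| ≤ v |e|` and `|e| ≤ v |a + b|`.
[cite: GraillatJezequel2020, §3.1.1 Proposition 3.2 with eq. (2)] -/
theorem abs_fastTwoSum_err_sub_corr_le {rd : K → K} {v : K} (hv : 0 ≤ v)
    (hacc : ∀ t, |rd t - t| ≤ v * |t|) (a b : K) :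
    |(a + b - rd (a + b)) - rd (a + b - rd (a + b))| ≤ v ^ 2 * |a + b| := by
  have h1 : |(a + b - rd (a + b)) - rd (a + b - rd (a + b))| ≤ v * |a + b - rd (a + b)| := by
    rw [abs_sub_comm]; exact hacc _
  have h2 : |a + b - rd (a + b)| ≤ v * |a + b| := by
    rw [abs_sub_comm]; exact hacc _
  calc |(a + b - rd (a + b)) - rd (a + b - rd (a + b))| ≤ v * |a + b - rd (a + b)| := h1
    _ ≤ v * (v * |a + b|) := mul_le_mul_of_nonneg_left h2 hv
    _ = v ^ 2 * |a + b| := by ring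

/-- PROPOSITION 3.2 (model form, second display). If moreover `|rd t - t| ≤ v |rd t|` for every
`t` (the second form of [GraillatJezequel2020, §2 eq. (1)], `fl(t) = t/(1 + ε₂)`), then
`|e - y| ≤ v² |x|` with `x = rd (a + b)` (printed: `4u² |x|`).
[cite: GraillatJezequel2020, §3.1.1 Proposition 3.2 with eq. (2)] -/
theorem abs_fastTwoSum_err_sub_corr_le' {rd : K → K} {v : K} (hv : 0 ≤ v)
    (hacc : ∀ t, |rd t - t| ≤ v * |t|) (hacc' : ∀ t, |rd t - t| ≤ v * |rd t|) (a b : K) :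
    |(a + b - rd (a + b)) - rd (a + b - rd (a + b))| ≤ v ^ 2 * |rd (a + b)| := by
  have h1 : |(a + b - rd (a + b)) - rd (a + b - rd (a + b))| ≤ v * |a + b - rd (a + b)| := by
    rw [abs_sub_comm]; exact hacc _
  have h2 : |a + b - rd (a + b)| ≤ v * |rd (a + b)| := by
    rw [abs_sub_comm]; exact hacc' _
  calc |(a + b - rd (a + b)) - rd (a + b - rd (a + b))| ≤ v * |a + b - rd (a + b)| := h1
    _ ≤ v * (v * |rd (a + b)|) := mul_le_mul_of_nonneg_left h2 hv
    _ = v ^ 2 * |rd (a + b)| := by ring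

/-! ## Section 4.1: classic recursive summation under one rounding (Algorithms 4 and 5) -/

/-- Algorithm 4 (`Sum`) with every addition rounded by `rd`: `s₀ = p₀`, `sᵢ₊₁ = rd (sᵢ + pᵢ₊₁)`.
It is also the high part `πᵢ` of Algorithm 6 (`FastCompSum`), whose `FastTwoSum` returns
`fl(πᵢ₋₁ + pᵢ)` first. [cite: GraillatJezequel2020, §4.1 Algorithm 4; §4.2 Algorithm 6] -/
def sumRd (rd : K → K) (p : ℕ → K) : ℕ → K
  | 0 => p 0
  | i + 1 => rd (sumRd rd p i + p (i + 1))

/-- DOWNWARD ROUNDING UNDER-ESTIMATES: if `rd t ≤ t` for every `t` then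
`Sinf = sumRd rd p n ≤ Σ pᵢ`.
[cite: GraillatJezequel2020, §4.1 Proposition 4.3] -/
theorem sumRd_le_sum {rd : K → K} (hdn : ∀ t, rd t ≤ t) (p : ℕ → K) :
    ∀ n : ℕ, sumRd rd p n ≤ ∑ i ∈ range (n + 1), p i
  | 0 => by simp [sumRd]
  | n + 1 => by
      have ih := sumRd_le_sum hdn p n
      have h := hdn (sumRd rd p n + p (n + 1))
      rw [Finset.sum_range_succ]
      simp only [sumRd]
      linarith

/-- UPWARD ROUNDING OVER-ESTIMATES: if `t ≤ rd t` for every `t` then `Σ pᵢ ≤ Ssup = sumRd rd p n`.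
[cite: GraillatJezequel2020, §4.1 Proposition 4.3] -/
theorem sum_le_sumRd {rd : K → K} (hup : ∀ t, t ≤ rd t) (p : ℕ → K) :
    ∀ n : ℕ, ∑ i ∈ range (n + 1), p i ≤ sumRd rd p n
  | 0 => by simp [sumRd]
  | n + 1 => by
      have ih := sum_le_sumRd hup p n
      have h := hup (sumRd rd p n + p (n + 1))
      rw [Finset.sum_range_succ]
      simp only [sumRd]
      linarith

/-- GRAILLAT–JÉZÉQUEL PROPOSITION 4.3 (model form): classic summation run with a downward rounding
`dn` and with an upward rounding `up` (Algorithm 5) encloses the sum: `Sinf ≤ Σ pᵢ ≤ Ssup`.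
[cite: GraillatJezequel2020, §4.1 Algorithm 5 and Proposition 4.3] -/
theorem sumRd_enclosure {dn up : K → K} (hdn : ∀ t, dn t ≤ t) (hup : ∀ t, t ≤ up t)
    (p : ℕ → K) (n : ℕ) :
    sumRd dn p n ≤ ∑ i ∈ range (n + 1), p i ∧ ∑ i ∈ range (n + 1), p i ≤ sumRd up p n :=
  ⟨sumRd_le_sum hdn p n, sum_le_sumRd hup p n⟩

/-! ## Section 4.2: compensated summation under a directed rounding (Algorithms 6 and 7) -/

omit [LinearOrder K] [IsStrictOrderedRing K] in
/-- The exact identity opening the proof of Proposition 4.6: if `π₀ = p₀` and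
`eᵢ = πᵢ + pᵢ₊₁ - πᵢ₊₁` is the (exact) error of step `i`, then `Σ_{i ≤ n} pᵢ = πₙ + Σ_{i < n} eᵢ`
("`s = πₙ + Σ eᵢ` where `πᵢ + eᵢ = πᵢ₋₁ + pᵢ`"). Pure algebra, any trace `π`.
[cite: GraillatJezequel2020, §4.2 proof of Proposition 4.6] -/
theorem sum_eq_acc_add_sum_err (p π : ℕ → K) (h0 : π 0 = p 0) :
    ∀ n : ℕ, ∑ i ∈ range (n + 1), p i = π n + ∑ i ∈ range n, (π i + p (i + 1) - π (i + 1))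
  | 0 => by simp [h0]
  | n + 1 => by
      rw [Finset.sum_range_succ, sum_eq_acc_add_sum_err p π h0 n, Finset.sum_range_succ]
      ring

/-- Monotone accumulation under rounding toward `+∞`: if `c ≤ σ₀` and `σᵢ + dᵢ ≤ σᵢ₊₁` for `i < n`
then `c + Σ_{i<n} dᵢ ≤ σₙ` (the step "as we use rounding toward `+∞`, `Σ qᵢ ≤ σₙ`").
[cite: GraillatJezequel2020, §4.2 proof of Proposition 4.6; §5.2 proof of Proposition 5.6] -/
theorem add_sum_le_of_acc_le (σ d : ℕ → K) (c : K) (h0 : c ≤ σ 0) :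
    ∀ n : ℕ, (∀ i < n, σ i + d i ≤ σ (i + 1)) → c + ∑ i ∈ range n, d i ≤ σ n
  | 0, _ => by simpa using h0
  | n + 1, h => by
      have ih := add_sum_le_of_acc_le σ d c h0 n fun i hi => h i (by omega)
      have hn := h n (by omega)
      rw [Finset.sum_range_succ]
      linarith

/-- Monotone accumulation under rounding toward `-∞`: if `σ₀ ≤ c` and `σᵢ₊₁ ≤ σᵢ + dᵢ` for `i < n`
then `σₙ ≤ c + Σ_{i<n} dᵢ` (the step "as we use rounding toward `-∞`, `σₙ ≤ Σ qᵢ`").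
[cite: GraillatJezequel2020, §4.2 proof of Proposition 4.6; §5.2 proof of Proposition 5.6] -/
theorem le_add_sum_of_le_acc (σ d : ℕ → K) (c : K) (h0 : σ 0 ≤ c) :
    ∀ n : ℕ, (∀ i < n, σ (i + 1) ≤ σ i + d i) → σ n ≤ c + ∑ i ∈ range n, d i
  | 0, _ => by simpa using h0
  | n + 1, h => by
      have ih := le_add_sum_of_le_acc σ d c h0 n fun i hi => h i (by omega)
      have hn := h n (by omega)
      rw [Finset.sum_range_succ]
      linarith

/-- PROOF OF PROPOSITION 4.6, rounding toward `+∞`, for ANY compensated-summation trace: if the high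
parts satisfy `π₀ = p₀`, each computed correction dominates the exact error, `eᵢ ≤ qᵢ`
(`FastTwoSum`: Proposition 3.3; `TwoSum`: Proposition 3.6), the corrections are accumulated upward,
`0 ≤ σ₀`, `σᵢ + qᵢ ≤ σᵢ₊₁`, and `πₙ + σₙ ≤ res`, then `Σ_{i ≤ n} pᵢ ≤ res`
("`s ≤ πₙ + Σ qᵢ ≤ πₙ + σₙ ≤ res`"). [cite: GraillatJezequel2020, §4.2 proof of Proposition 4.6] -/
theorem sum_le_of_compSum_trace (n : ℕ) (p π q σ : ℕ → K) (res : K) (hπ0 : π 0 = p 0)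
    (hq : ∀ i < n, π i + p (i + 1) - π (i + 1) ≤ q i) (hσ0 : 0 ≤ σ 0)
    (hσ : ∀ i < n, σ i + q i ≤ σ (i + 1)) (hres : π n + σ n ≤ res) :
    ∑ i ∈ range (n + 1), p i ≤ res := by
  rw [sum_eq_acc_add_sum_err p π hπ0 n]
  have h1 : ∑ i ∈ range n, (π i + p (i + 1) - π (i + 1)) ≤ ∑ i ∈ range n, q i :=
    Finset.sum_le_sum fun i hi => hq i (Finset.mem_range.mp hi)
  have h2 : 0 + ∑ i ∈ range n, q i ≤ σ n := add_sum_le_of_acc_le σ q 0 hσ0 n hσ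
  linarith

/-- PROOF OF PROPOSITION 4.6, rounding toward `-∞`, for any trace: `qᵢ ≤ eᵢ`, `σ₀ ≤ 0`,
`σᵢ₊₁ ≤ σᵢ + qᵢ`, `res ≤ πₙ + σₙ` give `res ≤ Σ_{i ≤ n} pᵢ`.
[cite: GraillatJezequel2020, §4.2 proof of Proposition 4.6] -/
theorem compSum_trace_le_sum (n : ℕ) (p π q σ : ℕ → K) (res : K) (hπ0 : π 0 = p 0)
    (hq : ∀ i < n, q i ≤ π i + p (i + 1) - π (i + 1)) (hσ0 : σ 0 ≤ 0)
    (hσ : ∀ i < n, σ (i + 1) ≤ σ i + q i) (hres : res ≤ π n + σ n) :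
    res ≤ ∑ i ∈ range (n + 1), p i := by
  rw [sum_eq_acc_add_sum_err p π hπ0 n]
  have h1 : ∑ i ∈ range n, q i ≤ ∑ i ∈ range n, (π i + p (i + 1) - π (i + 1)) :=
    Finset.sum_le_sum fun i hi => hq i (Finset.mem_range.mp hi)
  have h2 : σ n ≤ 0 + ∑ i ∈ range n, q i := le_add_sum_of_le_acc σ q 0 hσ0 n hσ
  linarith

/-- Algorithm 6, the exact error of step `i`: `eᵢ = πᵢ + pᵢ₊₁ - πᵢ₊₁` with `π = sumRd rd p`
(`πᵢ₊₁ = fl(πᵢ + pᵢ₊₁)`). Not a computed quantity.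
[cite: GraillatJezequel2020, §4.2 Algorithm 6 and proof of Proposition 4.6] -/
def fcsErr (rd : K → K) (p : ℕ → K) (i : ℕ) : K :=
  sumRd rd p i + p (i + 1) - sumRd rd p (i + 1)

/-- Algorithm 6, the computed `FastTwoSum` correction of step `i` in the model: `qᵢ = rd eᵢ`
(Proposition 3.1: `z = x - a` is exact, so `y = fl(b - z) = fl(e)`).
[cite: GraillatJezequel2020, §4.2 Algorithm 6; §3.1.1 Proposition 3.1] -/
def fcsCorr (rd : K → K) (p : ℕ → K) (i : ℕ) : K :=
  rd (fcsErr rd p i)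

/-- Algorithm 6, the accumulated corrections: `σ₀ = 0`, `σᵢ₊₁ = rd (σᵢ + qᵢ)`.
[cite: GraillatJezequel2020, §4.2 Algorithm 6] -/
def fcsSigma (rd : K → K) (p : ℕ → K) : ℕ → K
  | 0 => 0
  | i + 1 => rd (fcsSigma rd p i + fcsCorr rd p i)

/-- Algorithm 6 (`FastCompSum`) on `p₀ … pₙ` with every operation rounded by `rd`:
`res = rd (πₙ + σₙ)`. [cite: GraillatJezequel2020, §4.2 Algorithm 6] -/
def fastCompSum (rd : K → K) (p : ℕ → K) (n : ℕ) : K :=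
  rd (sumRd rd p n + fcsSigma rd p n)

omit [LinearOrder K] [IsStrictOrderedRing K] in
/-- `s = πₙ + Σ eᵢ` for Algorithm 6 run under any rounding map `rd`.
[cite: GraillatJezequel2020, §4.2 proof of Proposition 4.6] -/
theorem sum_eq_sumRd_add_sum_fcsErr (rd : K → K) (p : ℕ → K) (n : ℕ) :
    ∑ i ∈ range (n + 1), p i = sumRd rd p n + ∑ i ∈ range n, fcsErr rd p i :=
  sum_eq_acc_add_sum_err p (sumRd rd p) rfl n

/-- PROPOSITION 4.6, upper half: `FastCompSum` run with rounding toward `+∞` (`t ≤ rd t`)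
over-estimates, `Σ_{i ≤ n} pᵢ ≤ Ssup`. [cite: GraillatJezequel2020, §4.2 Proposition 4.6] -/
theorem sum_le_fastCompSum {rd : K → K} (hup : ∀ t, t ≤ rd t) (p : ℕ → K) (n : ℕ) :
    ∑ i ∈ range (n + 1), p i ≤ fastCompSum rd p n :=
  sum_le_of_compSum_trace n p (sumRd rd p) (fcsCorr rd p) (fcsSigma rd p) (fastCompSum rd p n)
    rfl (fun _ _ => hup _) (by simp [fcsSigma]) (fun _ _ => hup _) (hup _)

/-- PROPOSITION 4.6, lower half: `FastCompSum` run with rounding toward `-∞` (`rd t ≤ t`)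
under-estimates, `Sinf ≤ Σ_{i ≤ n} pᵢ`. [cite: GraillatJezequel2020, §4.2 Proposition 4.6] -/
theorem fastCompSum_le_sum {rd : K → K} (hdn : ∀ t, rd t ≤ t) (p : ℕ → K) (n : ℕ) :
    fastCompSum rd p n ≤ ∑ i ∈ range (n + 1), p i :=
  compSum_trace_le_sum n p (sumRd rd p) (fcsCorr rd p) (fcsSigma rd p) (fastCompSum rd p n)
    rfl (fun _ _ => hdn _) (by simp [fcsSigma]) (fun _ _ => hdn _) (hdn _)

/-- GRAILLAT–JÉZÉQUEL PROPOSITION 4.6 (model form): the compensated summation `FastCompSum` run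
with a downward rounding `dn` and with an upward rounding `up` (Algorithm 7) encloses the sum,
`Sinf ≤ Σ pᵢ ≤ Ssup`. [cite: GraillatJezequel2020, §4.2 Algorithm 7 and Proposition 4.6] -/
theorem fastCompSum_enclosure {dn up : K → K} (hdn : ∀ t, dn t ≤ t) (hup : ∀ t, t ≤ up t)
    (p : ℕ → K) (n : ℕ) :
    fastCompSum dn p n ≤ ∑ i ∈ range (n + 1), p i
      ∧ ∑ i ∈ range (n + 1), p i ≤ fastCompSum up p n :=
  ⟨fastCompSum_le_sum hdn p n, sum_le_fastCompSum hup p n⟩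

/-! ## Section 5.1: classic dot product under one rounding (Algorithms 8 and 9) -/

/-- Algorithm 8 (`Dot`) with every operation rounded by `rd`: `s₀ = rd (x₀ y₀)`,
`sᵢ₊₁ = rd (sᵢ + rd (xᵢ₊₁ yᵢ₊₁))`. It is also the high part `pᵢ` of Algorithm 10 (`CompDot`:
`TwoProdFMA` returns `fl(xᵢ yᵢ)` first, `TwoSum` returns `fl(pᵢ₋₁ + hᵢ)` first).
[cite: GraillatJezequel2020, §5.1 Algorithm 8; §5.2 Algorithm 10] -/
def dotRd (rd : K → K) (x y : ℕ → K) : ℕ → K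
  | 0 => rd (x 0 * y 0)
  | i + 1 => rd (dotRd rd x y i + rd (x (i + 1) * y (i + 1)))

/-- DOWNWARD ROUNDING UNDER-ESTIMATES: if `rd t ≤ t` for every `t` then
`Dinf = dotRd rd x y n ≤ xᵀy` (no sign condition: only `rd t ≤ t` at the computed values is used).
[cite: GraillatJezequel2020, §5.1 Proposition 5.3] -/
theorem dotRd_le_dot {rd : K → K} (hdn : ∀ t, rd t ≤ t) (x y : ℕ → K) :
    ∀ n : ℕ, dotRd rd x y n ≤ ∑ i ∈ range (n + 1), x i * y i
  | 0 => by simpa [dotRd] using hdn (x 0 * y 0)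
  | n + 1 => by
      have ih := dotRd_le_dot hdn x y n
      have h1 := hdn (x (n + 1) * y (n + 1))
      have h2 := hdn (dotRd rd x y n + rd (x (n + 1) * y (n + 1)))
      rw [Finset.sum_range_succ]
      simp only [dotRd]
      linarith

/-- UPWARD ROUNDING OVER-ESTIMATES: if `t ≤ rd t` for every `t` then `xᵀy ≤ Dsup = dotRd rd x y n`.
[cite: GraillatJezequel2020, §5.1 Proposition 5.3] -/
theorem dot_le_dotRd {rd : K → K} (hup : ∀ t, t ≤ rd t) (x y : ℕ → K) :
    ∀ n : ℕ, ∑ i ∈ range (n + 1), x i * y i ≤ dotRd rd x y n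
  | 0 => by simpa [dotRd] using hup (x 0 * y 0)
  | n + 1 => by
      have ih := dot_le_dotRd hup x y n
      have h1 := hup (x (n + 1) * y (n + 1))
      have h2 := hup (dotRd rd x y n + rd (x (n + 1) * y (n + 1)))
      rw [Finset.sum_range_succ]
      simp only [dotRd]
      linarith

/-- GRAILLAT–JÉZÉQUEL PROPOSITION 5.3 (model form): the classic dot product run with a downward
rounding `dn` and with an upward rounding `up` (Algorithm 9) encloses `xᵀy`: `Dinf ≤ xᵀy ≤ Dsup`.
[cite: GraillatJezequel2020, §5.1 Algorithm 9 and Proposition 5.3] -/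
theorem dotRd_enclosure {dn up : K → K} (hdn : ∀ t, dn t ≤ t) (hup : ∀ t, t ≤ up t)
    (x y : ℕ → K) (n : ℕ) :
    dotRd dn x y n ≤ ∑ i ∈ range (n + 1), x i * y i
      ∧ ∑ i ∈ range (n + 1), x i * y i ≤ dotRd up x y n :=
  ⟨dotRd_le_dot hdn x y n, dot_le_dotRd hup x y n⟩

/-! ## Section 5.2: compensated dot product under a directed rounding (Algorithms 10 and 11) -/

omit [LinearOrder K] [IsStrictOrderedRing K] in
/-- The exact identity opening the proof of Proposition 5.6: for a trace of Algorithm 10 with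
`hᵢ + rᵢ = xᵢ yᵢ` (`TwoProdFMA`, exact), `p₀ = h₀` and `eᵢ = pᵢ + hᵢ₊₁ - pᵢ₊₁` the exact error
of the `i`-th addition, `xᵀy = pₙ + (r₀ + Σ_{i<n} (eᵢ + rᵢ₊₁))`
(printed: `xᵀy = pₙ + s₁ + Σ_{i=2}^{n} (eᵢ + rᵢ)`). Pure algebra.
[cite: GraillatJezequel2020, §5.2 proof of Proposition 5.6] -/
theorem dot_eq_compDot_trace (x y h r p : ℕ → K) (hp0 : p 0 = h 0) (n : ℕ)
    (hhr : ∀ i < n + 1, h i + r i = x i * y i) :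
    ∑ i ∈ range (n + 1), x i * y i
      = p n + (r 0 + ∑ i ∈ range n, (p i + h (i + 1) - p (i + 1) + r (i + 1))) := by
  have hxy : ∑ i ∈ range (n + 1), x i * y i = ∑ i ∈ range (n + 1), (h i + r i) :=
    Finset.sum_congr rfl fun i hi => (hhr i (Finset.mem_range.mp hi)).symm
  rw [hxy, Finset.sum_add_distrib, sum_eq_acc_add_sum_err h p hp0 n, Finset.sum_range_succ' r n,
    Finset.sum_add_distrib]
  ring

/-- PROOF OF PROPOSITION 5.6, rounding toward `+∞`, for ANY trace of Algorithm 10: `hᵢ + rᵢ = xᵢ yᵢ`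
(`TwoProdFMA`), `p₀ = h₀`, the `TwoSum` correction dominates the exact error `eᵢ ≤ qᵢ`
(Proposition 3.6), `r₀ ≤ s₀`, `qᵢ + rᵢ₊₁ ≤ tᵢ` and `sᵢ + tᵢ ≤ sᵢ₊₁` (upward roundings of line 5),
`pₙ + sₙ ≤ res`; then `xᵀy ≤ res` ("`xᵀy ≤ pₙ + s₁ + Σ (qᵢ + rᵢ) ≤ pₙ + sₙ ≤ res`").
[cite: GraillatJezequel2020, §5.2 proof of Proposition 5.6] -/
theorem dot_le_of_compDot_trace (n : ℕ) (x y h r p q t s : ℕ → K) (res : K)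
    (hhr : ∀ i < n + 1, h i + r i = x i * y i) (hp0 : p 0 = h 0)
    (hq : ∀ i < n, p i + h (i + 1) - p (i + 1) ≤ q i) (hs0 : r 0 ≤ s 0)
    (ht : ∀ i < n, q i + r (i + 1) ≤ t i) (hs : ∀ i < n, s i + t i ≤ s (i + 1))
    (hres : p n + s n ≤ res) :
    ∑ i ∈ range (n + 1), x i * y i ≤ res := by
  rw [dot_eq_compDot_trace x y h r p hp0 n hhr]
  have h1 : ∑ i ∈ range n, (p i + h (i + 1) - p (i + 1) + r (i + 1)) ≤ ∑ i ∈ range n, t i :=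
    Finset.sum_le_sum fun i hi => by
      have hi' := Finset.mem_range.mp hi
      linarith [hq i hi', ht i hi']
  have h2 : r 0 + ∑ i ∈ range n, t i ≤ s n := add_sum_le_of_acc_le s t (r 0) hs0 n hs
  linarith

/-- PROOF OF PROPOSITION 5.6, rounding toward `-∞`, for any trace of Algorithm 10: `qᵢ ≤ eᵢ`,
`s₀ ≤ r₀`, `tᵢ ≤ qᵢ + rᵢ₊₁`, `sᵢ₊₁ ≤ sᵢ + tᵢ`, `res ≤ pₙ + sₙ` give `res ≤ xᵀy`.
[cite: GraillatJezequel2020, §5.2 proof of Proposition 5.6] -/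
theorem compDot_trace_le_dot (n : ℕ) (x y h r p q t s : ℕ → K) (res : K)
    (hhr : ∀ i < n + 1, h i + r i = x i * y i) (hp0 : p 0 = h 0)
    (hq : ∀ i < n, q i ≤ p i + h (i + 1) - p (i + 1)) (hs0 : s 0 ≤ r 0)
    (ht : ∀ i < n, t i ≤ q i + r (i + 1)) (hs : ∀ i < n, s (i + 1) ≤ s i + t i)
    (hres : res ≤ p n + s n) :
    res ≤ ∑ i ∈ range (n + 1), x i * y i := by
  rw [dot_eq_compDot_trace x y h r p hp0 n hhr]
  have h1 : ∑ i ∈ range n, t i ≤ ∑ i ∈ range n, (p i + h (i + 1) - p (i + 1) + r (i + 1)) :=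
    Finset.sum_le_sum fun i hi => by
      have hi' := Finset.mem_range.mp hi
      linarith [hq i hi', ht i hi']
  have h2 : s n ≤ r 0 + ∑ i ∈ range n, t i := le_add_sum_of_le_acc s t (r 0) hs0 n hs
  linarith

/-- Algorithm 10, the accumulated corrections, with every operation rounded by `rd` and the `TwoSum`
correction an ORACLE `cr a b` (under a directed rounding it is NOT `fl` of the error in general;
Proposition 3.6 only places it on the correct side of the error): `s₀ = x₀ y₀ - rd (x₀ y₀)` (the
exact `TwoProdFMA` residual), `sᵢ₊₁ = rd (sᵢ + rd (qᵢ + rᵢ₊₁))` with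
`qᵢ = cr pᵢ (rd (xᵢ₊₁ yᵢ₊₁))`, `rᵢ₊₁ = xᵢ₊₁ yᵢ₊₁ - rd (xᵢ₊₁ yᵢ₊₁)`, `p = dotRd rd x y`.
[cite: GraillatJezequel2020, §5.2 Algorithm 10] -/
def cdS (rd : K → K) (cr : K → K → K) (x y : ℕ → K) : ℕ → K
  | 0 => x 0 * y 0 - rd (x 0 * y 0)
  | i + 1 => rd (cdS rd cr x y i + rd (cr (dotRd rd x y i) (rd (x (i + 1) * y (i + 1)))
              + (x (i + 1) * y (i + 1) - rd (x (i + 1) * y (i + 1)))))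

/-- Algorithm 10 (`CompDot`) on `(x₀, y₀) … (xₙ, yₙ)` rounded by `rd`, `TwoSum` correction oracle
`cr`: `res = rd (pₙ + sₙ)`. [cite: GraillatJezequel2020, §5.2 Algorithm 10] -/
def compDotRd (rd : K → K) (cr : K → K → K) (x y : ℕ → K) (n : ℕ) : K :=
  rd (dotRd rd x y n + cdS rd cr x y n)

/-- PROPOSITION 5.6, upper half: `CompDot` run with rounding toward `+∞` (`t ≤ rd t`), with a
`TwoSum` whose correction dominates the error (`a + b - rd (a + b) ≤ cr a b`, Proposition 3.6;
the model `FastTwoSum` correction `cr a b = rd (a + b - rd (a + b))` qualifies by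
`fastTwoSum_err_le_corr`), over-estimates: `xᵀy ≤ Dsup`.
[cite: GraillatJezequel2020, §5.2 Proposition 5.6] -/
theorem dot_le_compDotRd {rd : K → K} {cr : K → K → K} (hup : ∀ t, t ≤ rd t)
    (hcr : ∀ a b, a + b - rd (a + b) ≤ cr a b) (x y : ℕ → K) (n : ℕ) :
    ∑ i ∈ range (n + 1), x i * y i ≤ compDotRd rd cr x y n :=
  dot_le_of_compDot_trace n x y (fun i => rd (x i * y i)) (fun i => x i * y i - rd (x i * y i))
    (dotRd rd x y) (fun i => cr (dotRd rd x y i) (rd (x (i + 1) * y (i + 1))))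
    (fun i => rd (cr (dotRd rd x y i) (rd (x (i + 1) * y (i + 1)))
      + (x (i + 1) * y (i + 1) - rd (x (i + 1) * y (i + 1)))))
    (cdS rd cr x y) (compDotRd rd cr x y n)
    (fun _ _ => by ring) rfl (fun _ _ => hcr _ _) (by simp [cdS]) (fun _ _ => hup _)
    (fun _ _ => hup _) (hup _)

/-- PROPOSITION 5.6, lower half: `CompDot` run with rounding toward `-∞` (`rd t ≤ t`), with a
`TwoSum` whose correction is dominated by the error (`cr a b ≤ a + b - rd (a + b)`,
Proposition 3.6), under-estimates: `Dinf ≤ xᵀy`.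
[cite: GraillatJezequel2020, §5.2 Proposition 5.6] -/
theorem compDotRd_le_dot {rd : K → K} {cr : K → K → K} (hdn : ∀ t, rd t ≤ t)
    (hcr : ∀ a b, cr a b ≤ a + b - rd (a + b)) (x y : ℕ → K) (n : ℕ) :
    compDotRd rd cr x y n ≤ ∑ i ∈ range (n + 1), x i * y i :=
  compDot_trace_le_dot n x y (fun i => rd (x i * y i)) (fun i => x i * y i - rd (x i * y i))
    (dotRd rd x y) (fun i => cr (dotRd rd x y i) (rd (x (i + 1) * y (i + 1))))
    (fun i => rd (cr (dotRd rd x y i) (rd (x (i + 1) * y (i + 1)))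
      + (x (i + 1) * y (i + 1) - rd (x (i + 1) * y (i + 1)))))
    (cdS rd cr x y) (compDotRd rd cr x y n)
    (fun _ _ => by ring) rfl (fun _ _ => hcr _ _) (by simp [cdS]) (fun _ _ => hdn _)
    (fun _ _ => hdn _) (hdn _)

/-- GRAILLAT–JÉZÉQUEL PROPOSITION 5.6 (model form): `CompDot` run with a downward rounding `dn`
(correction oracle `cdn` on the lower side of the error) and with an upward rounding `up` (oracle
`cup` on the upper side), Algorithm 11, encloses the dot product: `Dinf ≤ xᵀy ≤ Dsup`.
[cite: GraillatJezequel2020, §5.2 Algorithm 11 and Proposition 5.6] -/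
theorem compDotRd_enclosure {dn up : K → K} {cdn cup : K → K → K} (hdn : ∀ t, dn t ≤ t)
    (hcdn : ∀ a b, cdn a b ≤ a + b - dn (a + b)) (hup : ∀ t, t ≤ up t)
    (hcup : ∀ a b, a + b - up (a + b) ≤ cup a b) (x y : ℕ → K) (n : ℕ) :
    compDotRd dn cdn x y n ≤ ∑ i ∈ range (n + 1), x i * y i
      ∧ ∑ i ∈ range (n + 1), x i * y i ≤ compDotRd up cup x y n :=
  ⟨compDotRd_le_dot hdn hcdn x y n, dot_le_compDotRd hup hcup x y n⟩

/-! ## Section 6.2: compensated Horner scheme under a directed rounding, `x ≥ 0`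
(Algorithms 14 and 15; Proposition 6.1 for Algorithm 13 is `Higham2002.hornerRd_enclosure`) -/

/-- Horner-type monotone accumulation, rounding toward `+∞`: for `x ≥ 0`, if `0 ≤ rₙ` and
`rᵢ₊₁ x + cᵢ ≤ rᵢ` for `i < n` then `Σ_{i<n} cᵢ xⁱ ≤ r₀` (the step "as we use rounding toward
`+∞`, `s₀ + Σ πᵢ xⁱ + Σ σᵢ xⁱ ≤ s₀ + r₀`"; `cᵢ = πᵢ + σᵢ`, line 6 of Algorithm 14).
[cite: GraillatJezequel2020, §6.2 proof of Proposition 6.3] -/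
theorem sum_mul_pow_le_of_horner_acc {x : K} (hx : 0 ≤ x) :
    ∀ (n : ℕ) (r c : ℕ → K), 0 ≤ r n → (∀ i < n, r (i + 1) * x + c i ≤ r i) →
      ∑ i ∈ range n, c i * x ^ i ≤ r 0
  | 0, r, c, hrn, _ => by simpa using hrn
  | n + 1, r, c, hrn, hr => by
      have ih := sum_mul_pow_le_of_horner_acc hx n (fun i => r (i + 1)) (fun i => c (i + 1)) hrn
        fun i hi => hr (i + 1) (by omega)
      have h0 : r (0 + 1) * x + c 0 ≤ r 0 := hr 0 (by omega)
      simp only [zero_add] at h0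
      rw [sum_mul_pow_succ_eq' c x n]
      have h1 : (∑ i ∈ range n, c (i + 1) * x ^ i) * x ≤ r 1 * x := mul_le_mul_of_nonneg_right ih hx
      linarith
where
  /-- Horner's recurrence on a truncated polynomial value:
  `Σ_{i<n+1} fᵢ yⁱ = (Σ_{i<n} fᵢ₊₁ yⁱ) · y + f₀`. [cite: GraillatJezequel2020, §6.1 Algorithm 12] -/
  sum_mul_pow_succ_eq' (f : ℕ → K) (y : K) (n : ℕ) :
      ∑ i ∈ range (n + 1), f i * y ^ i = (∑ i ∈ range n, f (i + 1) * y ^ i) * y + f 0 := by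
    rw [Finset.sum_range_succ', Finset.sum_mul]
    simp only [pow_zero, mul_one, pow_succ, mul_assoc]

/-- Horner-type monotone accumulation, rounding toward `-∞`: for `x ≥ 0`, if `rₙ ≤ 0` and
`rᵢ ≤ rᵢ₊₁ x + cᵢ` for `i < n` then `r₀ ≤ Σ_{i<n} cᵢ xⁱ`.
[cite: GraillatJezequel2020, §6.2 proof of Proposition 6.3] -/
theorem le_sum_mul_pow_of_horner_acc {x : K} (hx : 0 ≤ x) :
    ∀ (n : ℕ) (r c : ℕ → K), r n ≤ 0 → (∀ i < n, r i ≤ r (i + 1) * x + c i) →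
      r 0 ≤ ∑ i ∈ range n, c i * x ^ i
  | 0, r, c, hrn, _ => by simpa using hrn
  | n + 1, r, c, hrn, hr => by
      have ih := le_sum_mul_pow_of_horner_acc hx n (fun i => r (i + 1)) (fun i => c (i + 1)) hrn
        fun i hi => hr (i + 1) (by omega)
      have h0 : r 0 ≤ r (0 + 1) * x + c 0 := hr 0 (by omega)
      simp only [zero_add] at h0
      rw [sum_mul_pow_le_of_horner_acc.sum_mul_pow_succ_eq' c x n]
      have h1 : r 1 * x ≤ (∑ i ∈ range n, c (i + 1) * x ^ i) * x := mul_le_mul_of_nonneg_right ih hx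
      linarith

/-- PROOF OF PROPOSITION 6.3, rounding toward `+∞`, for ANY trace of Algorithm 14 (`CompHorner`),
`x ≥ 0`: `sₙ = aₙ`; `sᵢ₊₁ x = pᵢ + πᵢ` (`TwoProdFMA`, exact); `pᵢ + aᵢ = sᵢ + τᵢ` (`τᵢ` the exact
error of the addition, "not necessarily a floating-point number") with the computed correction
`σᵢ ≥ τᵢ` (Proposition 3.3); `rₙ ≥ 0`, `rᵢ ≥ rᵢ₊₁ x + (πᵢ + σᵢ)` (line 6 rounded upward);
`res ≥ s₀ + r₀`. Then `p(x) = s₀ + p_π(x) + p_τ(x) ≤ s₀ + Σ (πᵢ + σᵢ) xⁱ ≤ s₀ + r₀ ≤ res`.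
[cite: GraillatJezequel2020, §6.2 proof of Proposition 6.3] -/
theorem sum_le_of_compHorner_trace {x : K} (hx : 0 ≤ x) (n : ℕ) (a s p π σ τ r : ℕ → K)
    (res : K) (hsn : s n = a n) (hp : ∀ i < n, s (i + 1) * x = p i + π i)
    (hτ : ∀ i < n, p i + a i = s i + τ i) (hσ : ∀ i < n, τ i ≤ σ i) (hrn : 0 ≤ r n)
    (hr : ∀ i < n, r (i + 1) * x + (π i + σ i) ≤ r i) (hres : s 0 + r 0 ≤ res) :
    ∑ i ∈ range (n + 1), a i * x ^ i ≤ res := by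
  rw [← eftHorner_add_sum_eq x n a s p π τ hsn hp hτ]
  have h1 : ∑ i ∈ range n, (π i + τ i) * x ^ i ≤ ∑ i ∈ range n, (π i + σ i) * x ^ i :=
    Finset.sum_le_sum fun i hi =>
      mul_le_mul_of_nonneg_right ((add_le_add_iff_left (π i)).mpr (hσ i (Finset.mem_range.mp hi)))
        (pow_nonneg hx i)
  have h2 : ∑ i ∈ range n, (π i + σ i) * x ^ i ≤ r 0 :=
    sum_mul_pow_le_of_horner_acc hx n r (fun i => π i + σ i) hrn hr
  linarith

/-- PROOF OF PROPOSITION 6.3, rounding toward `-∞`, for any trace of Algorithm 14, `x ≥ 0`: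
`σᵢ ≤ τᵢ`, `rₙ ≤ 0`, `rᵢ ≤ rᵢ₊₁ x + (πᵢ + σᵢ)`, `res ≤ s₀ + r₀` give `res ≤ p(x)`.
[cite: GraillatJezequel2020, §6.2 proof of Proposition 6.3] -/
theorem compHorner_trace_le_sum {x : K} (hx : 0 ≤ x) (n : ℕ) (a s p π σ τ r : ℕ → K)
    (res : K) (hsn : s n = a n) (hp : ∀ i < n, s (i + 1) * x = p i + π i)
    (hτ : ∀ i < n, p i + a i = s i + τ i) (hσ : ∀ i < n, σ i ≤ τ i) (hrn : r n ≤ 0)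
    (hr : ∀ i < n, r i ≤ r (i + 1) * x + (π i + σ i)) (hres : res ≤ s 0 + r 0) :
    res ≤ ∑ i ∈ range (n + 1), a i * x ^ i := by
  rw [← eftHorner_add_sum_eq x n a s p π τ hsn hp hτ]
  have h1 : ∑ i ∈ range n, (π i + σ i) * x ^ i ≤ ∑ i ∈ range n, (π i + τ i) * x ^ i :=
    Finset.sum_le_sum fun i hi =>
      mul_le_mul_of_nonneg_right ((add_le_add_iff_left (π i)).mpr (hσ i (Finset.mem_range.mp hi)))
        (pow_nonneg hx i)
  have h2 : r 0 ≤ ∑ i ∈ range n, (π i + σ i) * x ^ i :=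
    le_sum_mul_pow_of_horner_acc hx n r (fun i => π i + σ i) hrn hr
  linarith

/-- Algorithm 14 (`CompHorner`), the correcting term `r₀`, with every operation rounded by `rd`,
for the degree-`n` polynomial with coefficients `a₀ … aₙ`: `rₙ = 0` and, peeling off the last step
(tail polynomial `a ∘ succ` of degree `n`), `r₀ = rd (rd (r₁ x) + rd (π₀ + σ₀))` where
`s₁ = hornerRd rd x (a ∘ succ) n`, `p₀ = rd (s₁ x)`, `π₀ = s₁ x - p₀` (`TwoProdFMA`, exact),
`s₀ = rd (p₀ + a₀)`, `τ₀ = p₀ + a₀ - s₀`, `σ₀ = rd τ₀` (`FastTwoSum` in the model, Proposition 3.1).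
The high part `s₀` of Algorithm 14 is `Higham2002.hornerRd rd x a n`.
[cite: GraillatJezequel2020, §6.2 Algorithm 14] -/
def compHornerRdCorr (rd : K → K) (x : K) : (ℕ → K) → ℕ → K
  | _, 0 => 0
  | a, n + 1 =>
      let s₁ := hornerRd rd x (fun i => a (i + 1)) n
      let p₀ := rd (s₁ * x)
      let s₀ := rd (p₀ + a 0)
      rd (rd (compHornerRdCorr rd x (fun i => a (i + 1)) n * x)
        + rd ((s₁ * x - p₀) + rd (p₀ + a 0 - s₀)))

/-- Algorithm 14 (`CompHorner`) rounded by `rd`: `res = rd (s₀ + r₀)`.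
[cite: GraillatJezequel2020, §6.2 Algorithm 14] -/
def compHornerRd (rd : K → K) (x : K) (a : ℕ → K) (n : ℕ) : K :=
  rd (hornerRd rd x a n + compHornerRdCorr rd x a n)

/-- Rounding toward `+∞`, `x ≥ 0`: BEFORE the final addition, `p(x) ≤ s₀ + r₀`
(induction on the degree: `p(x) = q(x)·x + a₀ ≤ (s₁ + r₁) x + a₀ = s₀ + τ₀ + π₀ + r₁ x
≤ s₀ + rd (rd (r₁ x) + rd (π₀ + σ₀)) = s₀ + r₀`, using `τ₀ ≤ σ₀ = rd τ₀`).
[cite: GraillatJezequel2020, §6.2 proof of Proposition 6.3] -/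
theorem sum_le_hornerRd_add_compHornerRdCorr {rd : K → K} (hup : ∀ t, t ≤ rd t) {x : K}
    (hx : 0 ≤ x) :
    ∀ (n : ℕ) (a : ℕ → K),
      ∑ i ∈ range (n + 1), a i * x ^ i ≤ hornerRd rd x a n + compHornerRdCorr rd x a n
  | 0, a => by simp [hornerRd, compHornerRdCorr]
  | n + 1, a => by
      have ih := sum_le_hornerRd_add_compHornerRdCorr hup hx n (fun i => a (i + 1))
      simp only [hornerRd, compHornerRdCorr]
      rw [sum_mul_pow_succ_eq a x n]
      set s₁ := hornerRd rd x (fun i => a (i + 1)) n with hs₁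
      set r₁ := compHornerRdCorr rd x (fun i => a (i + 1)) n with hr₁
      have h1 : (∑ i ∈ range (n + 1), a (i + 1) * x ^ i) * x ≤ (s₁ + r₁) * x :=
        mul_le_mul_of_nonneg_right ih hx
      have h2 := hup (r₁ * x)
      have h3 := hup (rd (s₁ * x) + a 0 - rd (rd (s₁ * x) + a 0))
      have h4 := hup ((s₁ * x - rd (s₁ * x)) + rd (rd (s₁ * x) + a 0 - rd (rd (s₁ * x) + a 0)))
      have h5 := hup (rd (r₁ * x)
        + rd ((s₁ * x - rd (s₁ * x)) + rd (rd (s₁ * x) + a 0 - rd (rd (s₁ * x) + a 0))))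
      linarith

/-- Rounding toward `-∞`, `x ≥ 0`: before the final addition, `s₀ + r₀ ≤ p(x)`.
[cite: GraillatJezequel2020, §6.2 proof of Proposition 6.3] -/
theorem hornerRd_add_compHornerRdCorr_le_sum {rd : K → K} (hdn : ∀ t, rd t ≤ t) {x : K}
    (hx : 0 ≤ x) :
    ∀ (n : ℕ) (a : ℕ → K),
      hornerRd rd x a n + compHornerRdCorr rd x a n ≤ ∑ i ∈ range (n + 1), a i * x ^ i
  | 0, a => by simp [hornerRd, compHornerRdCorr]
  | n + 1, a => by
      have ih := hornerRd_add_compHornerRdCorr_le_sum hdn hx n (fun i => a (i + 1))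
      simp only [hornerRd, compHornerRdCorr]
      rw [sum_mul_pow_succ_eq a x n]
      set s₁ := hornerRd rd x (fun i => a (i + 1)) n with hs₁
      set r₁ := compHornerRdCorr rd x (fun i => a (i + 1)) n with hr₁
      have h1 : (s₁ + r₁) * x ≤ (∑ i ∈ range (n + 1), a (i + 1) * x ^ i) * x :=
        mul_le_mul_of_nonneg_right ih hx
      have h2 := hdn (r₁ * x)
      have h3 := hdn (rd (s₁ * x) + a 0 - rd (rd (s₁ * x) + a 0))
      have h4 := hdn ((s₁ * x - rd (s₁ * x)) + rd (rd (s₁ * x) + a 0 - rd (rd (s₁ * x) + a 0)))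
      have h5 := hdn (rd (r₁ * x)
        + rd ((s₁ * x - rd (s₁ * x)) + rd (rd (s₁ * x) + a 0 - rd (rd (s₁ * x) + a 0))))
      linarith

/-- PROPOSITION 6.3, upper half: `CompHorner` run with rounding toward `+∞` (`t ≤ rd t`) at
`x ≥ 0` over-estimates, `p(x) ≤ Esup`. [cite: GraillatJezequel2020, §6.2 Proposition 6.3] -/
theorem sum_le_compHornerRd {rd : K → K} (hup : ∀ t, t ≤ rd t) {x : K} (hx : 0 ≤ x) (n : ℕ)
    (a : ℕ → K) : ∑ i ∈ range (n + 1), a i * x ^ i ≤ compHornerRd rd x a n :=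
  (sum_le_hornerRd_add_compHornerRdCorr hup hx n a).trans (hup _)

/-- PROPOSITION 6.3, lower half: `CompHorner` run with rounding toward `-∞` (`rd t ≤ t`) at
`x ≥ 0` under-estimates, `Einf ≤ p(x)`. [cite: GraillatJezequel2020, §6.2 Proposition 6.3] -/
theorem compHornerRd_le_sum {rd : K → K} (hdn : ∀ t, rd t ≤ t) {x : K} (hx : 0 ≤ x) (n : ℕ)
    (a : ℕ → K) : compHornerRd rd x a n ≤ ∑ i ∈ range (n + 1), a i * x ^ i :=
  (hdn _).trans (hornerRd_add_compHornerRdCorr_le_sum hdn hx n a)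

/-- GRAILLAT–JÉZÉQUEL PROPOSITION 6.3 (model form): for `x ≥ 0`, the compensated Horner scheme run
with a downward rounding `dn` and with an upward rounding `up` (Algorithm 15) encloses the value,
`Einf ≤ p(x) ≤ Esup`. [cite: GraillatJezequel2020, §6.2 Algorithm 15 and Proposition 6.3] -/
theorem compHornerRd_enclosure {dn up : K → K} (hdn : ∀ t, dn t ≤ t) (hup : ∀ t, t ≤ up t)
    {x : K} (hx : 0 ≤ x) (n : ℕ) (a : ℕ → K) :
    compHornerRd dn x a n ≤ ∑ i ∈ range (n + 1), a i * x ^ i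
      ∧ ∑ i ∈ range (n + 1), a i * x ^ i ≤ compHornerRd up x a n :=
  ⟨compHornerRd_le_sum hdn hx n a, sum_le_compHornerRd hup hx n a⟩

end Literature.ComputerArithmetic.GraillatJezequel2020
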